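import Literature.Algebra.Homology.LaurentCechGradedQuotient
import HarnessLib

/-!
# Functoriality of the Čech complexes of graded quotients; presentation independence

Hartshorne, *Algebraic Geometry*, III §5, proof of Thm. 5.1 (p. 225): the Čech complex of
`⊕_n 𝓕(n)` on the standard cover of `ℙ^r_A` consists of the localizations "`Γ(U_{i₀…i_p}, 𝒪(n))` …
is just the degree-`n` part of `S_{x_{i₀}⋯x_{i_p}}`"; II Prop. 5.11 / Ex. 5.9: the functor
`M ↦ M~` from graded `S`-modules to quasi-coherent sheaves on `Proj S`, with
`M~(U_f) = (M_f)_0`; Görtz–Wedhorn I (13.1) (PDF p. 466): homogeneous submodules, graded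
localization `(M_f)_d`, and their functoriality in degree-preserving homomorphisms.

`Literature/Algebra/Homology/LaurentCechGradedQuotient` attached to a graded quotient
`M = F_e ⧸ K` of a free graded module `F_e = ⊕_j P(-e_j)` (`P = A[x₀,…,x_r]`, `K ⊆ F_e` a
`P`-submodule) the Čech complex `LaurentCech.quot e K d = Č_d(M)` of `M~(d)` on the standard cover.
This file makes that construction FUNCTORIAL in the graded module and proves that it only
depends on `M`, not on the presentation:

* `extL_mem_loc_of_map_le`, `extL_comp`, `extL_id`, `isDegZero_id`, `IsDegZero.comp` — complements
  on the Laurent extension `φ_L` of a `P`-linear `φ : F_{e'} → F_e` (`LaurentCechExact.extL`);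
* **`LaurentCech.cechMapOf φ : Č_d(K') ⟶ Č_d(K)`** for `φ` of degree zero (`IsDegZero`) with
  `φ(K') ⊆ K` (values `φ_L`), with `cechMapOf_comp` / `cechMapOf_id` (a functor), compatibility
  with the inclusions (`inclusion_comp_cechMapOf`) and with multiplication by homogeneous
  polynomials (`smulMap_comp_cechMapOf`);
* **`LaurentCech.quotMapOf φ : Č_d(F_{e'} ⧸ K') ⟶ Č_d(F_e ⧸ K)`** — the induced map of the Čech
  complexes of the quotients (`cokernel.map`), functorial (`quotMapOf_comp`, `quotMapOf_id`),
  `P`-linear (`quotSMul_comp_quotMapOf`) and compatible with the restrictions `quotRes`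
  (`quotRes_comp_quotMapOf`): the graded-module homomorphism `M' → M` induces
  `Č(M'~(d)) → Č(M~(d))`;
* **`isIso_quotMapOf` — presentation independence**: if `φ` induces an ISOMORPHISM of graded
  modules `F_{e'} ⧸ K' ≅ F_e ⧸ K` (`φ(K') ⊆ K`, `φ⁻¹(K) ⊆ K'`, `φ(F_{e'}) + K = F_e`; `K` graded),
  then
  `quotMapOf φ` is an isomorphism of cochain complexes in every twist `d` (degreewise: injectivity
  by clearing denominators, `mem_loc_of_extL_mem_loc`; surjectivity by projecting a decomposition
  onto its degree, `exists_extL_add_of_sup_eq_top` — the exactness of `M ↦ (M_{x_s})_d`), hence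
  `isIso_homologyMap_quotMapOf`: **the Čech cohomology `H^i(Č_d(F_e ⧸ K))` is an invariant of the
  graded module `M = F_e ⧸ K`** (e.g. of `S ⧸ I` for a closed subscheme `V₊(I)`, independently
  of the chosen generators and syzygies).

Everything is proved; no named facts; definitions with bodies (`cechMapOf`, `quotMapOf`).
Not here: dependence on `M` only in high degrees (`M~ = M'~` when `M_{≥n} = M'_{≥n}`, II Ex. 5.9),
and change of the homogeneous coordinates (which changes the standard cover).

## References
* [Hartshorne1977] R. Hartshorne, *Algebraic Geometry*, GTM 52 (1977), III Thm. 5.1 (proof,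
  p. 225), II Prop. 5.11, II Ex. 5.9 (p. 125), III Ex. 5.5 (p. 231).
* [GortzWedhorn2020] U. Görtz, T. Wedhorn, *Algebraic Geometry I: Schemes* (2nd ed., 2020),
  (13.1) (PDF p. 466).
-/

noncomputable section

open CategoryTheory CategoryTheory.Limits Pointwise

universe u

namespace Literature.Algebra.Homology

namespace LaurentCech

open OrderedCech TopCohomology

variable {A : Type u} [CommRing A] {r : ℕ} {J J' : Type} (e : J → ℤ) (e' : J' → ℤ)

/-! ### Degree-zero maps: identity and composition -/

section DegZero

variable {e e'}

/-- The identity is of degree zero. [cite: GortzWedhorn2020, (13.1) (PDF p. 466)] -/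
theorem isDegZero_id : IsDegZero e e (LinearMap.id : (J → P A r) →ₗ[P A r] (J → P A r)) :=
  fun _ _ => rfl

/-- Composites of degree-zero maps are of degree zero.
[cite: GortzWedhorn2020, (13.1) (PDF p. 466)] -/
theorem IsDegZero.comp {J'' : Type} {e'' : J'' → ℤ} {φ : (J' → P A r) →ₗ[P A r] (J → P A r)}
    {ψ : (J'' → P A r) →ₗ[P A r] (J' → P A r)} (hφ : IsDegZero e e' φ) (hψ : IsDegZero e' e'' ψ) :
    IsDegZero e e'' (φ ∘ₗ ψ) := by
  intro dd w
  rw [LinearMap.comp_apply, hψ, hφ, LinearMap.comp_apply]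

end DegZero

variable [Fintype J'] [DecidableEq J'] (φ : (J' → P A r) →ₗ[P A r] (J → P A r))

/-! ### The Laurent extension `φ_L`: complements -/

section ExtL

/-- `φ_L` maps `K'_{x_s}` into `K_{x_s}` as soon as `φ(K') ⊆ K`.
[cite: GortzWedhorn2020, (13.1) (PDF p. 466)] -/
theorem extL_mem_loc_of_map_le {K' : Submodule (P A r) (J' → P A r)}
    {K : Submodule (P A r) (J → P A r)} (hK : K'.map φ ≤ K) (s : Finset (Fin (r + 1)))
    {w : J' → L A r} (hw : w ∈ loc K' s) : extL φ w ∈ loc K s := by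
  obtain ⟨N, u, hu, hNu⟩ := hw
  refine ⟨N, φ u, hK (Submodule.mem_map_of_mem hu), ?_⟩
  rw [← extL_smul, hNu, extL_ιK]

/-- `φ_L` maps `(K'_{x_s})_d` into `(K_{x_s})_d` for `φ` of degree zero with `φ(K') ⊆ K`.
[cite: GortzWedhorn2020, (13.1) (PDF p. 466)] -/
theorem extL_mem_locDeg_of_map_le (hφ : IsDegZero e e' φ) {K' : Submodule (P A r) (J' → P A r)}
    {K : Submodule (P A r) (J → P A r)} (hK : K'.map φ ≤ K) (s : Finset (Fin (r + 1))) (d : ℤ)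
    {w : J' → L A r} (hw : w ∈ locDeg e' K' s d) : extL φ w ∈ locDeg e K s d :=
  (mem_locDeg _ _).2 ⟨extL_mem_loc_of_map_le φ hK s ((mem_locDeg _ _).1 hw).1,
    extL_mem_Kdeg hφ ((mem_locDeg _ _).1 hw).2⟩

/-- **`φ_L` is functorial: `(φ ∘ ψ)_L = φ_L ∘ ψ_L`.**
[cite: GortzWedhorn2020, (13.1) (PDF p. 466)] -/
theorem extL_comp {J'' : Type} [Fintype J''] [DecidableEq J'']
    (ψ : (J'' → P A r) →ₗ[P A r] (J' → P A r)) (w : J'' → L A r) :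
    extL (φ ∘ₗ ψ) w = extL φ (extL ψ w) := by
  conv_rhs => rw [extL_apply ψ w, map_sum]
  rw [extL_apply]
  refine Finset.sum_congr rfl fun h _ => ?_
  rw [extL_smul, extL_ιK, LinearMap.comp_apply]

/-- **`(id)_L = id`.** [cite: GortzWedhorn2020, (13.1) (PDF p. 466)] -/
theorem extL_id [Fintype J] [DecidableEq J] (w : J → L A r) :
    extL (LinearMap.id : (J → P A r) →ₗ[P A r] (J → P A r)) w = w := by
  rw [extL_apply]
  conv_rhs => rw [← Finset.univ_sum_single w]
  refine Finset.sum_congr rfl fun h _ => ?_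
  rw [LinearMap.id_apply]
  funext j
  rw [Pi.smul_apply, ιK_apply, smul_eq_mul]
  by_cases hj : j = h
  · subst hj; rw [Pi.single_eq_same, Pi.single_eq_same, map_one, mul_one]
  · rw [Pi.single_eq_of_ne hj, Pi.single_eq_of_ne hj, map_zero, mul_zero]

end ExtL

/-! ### The cochain map `Č_d(K') ⟶ Č_d(K)` of a degree-zero homomorphism -/

section CechMap

variable {e e' φ}

/-- **The cochain map `Č_d(K') ⟶ Č_d(K)` induced by a degree-zero `P`-linear `φ : F_{e'} → F_e` with
`φ(K') ⊆ K`** (values: `φ_L` applied to every vertex value; `OrderedCech.complexMap` of `extL φ`) —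
the functoriality of the Čech complex in the graded module.
[cite: Hartshorne1977, III Thm. 5.1 (proof, p. 225)]
[cite: GortzWedhorn2020, (13.1) (PDF p. 466)] -/
def cechMapOf (hφ : IsDegZero e e' φ) (K' : Submodule (P A r) (J' → P A r))
    (K : Submodule (P A r) (J → P A r)) (hK : K'.map φ ≤ K) (d : ℤ) :
    cech e' K' d ⟶ cech e K d :=
  complexMap (F := fun s => locDeg e' K' s d) (G := fun s => locDeg e K s d) (extL φ)
    (fun s _ hv => extL_mem_locDeg_of_map_le e e' φ hφ hK s d hv) (locDeg_mono e' K' d)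
    (locDeg_mono e K d)

/-- Values of `cechMapOf`: `(φ x)_σ = φ_L (x_σ)`.
[cite: Hartshorne1977, III Thm. 5.1 (proof, p. 225)] -/
@[simp] theorem cechMapOf_f_apply_coe (hφ : IsDegZero e e' φ) (K' : Submodule (P A r) (J' → P A r))
    (K : Submodule (P A r) (J → P A r)) (hK : K'.map φ ≤ K) (d i : ℤ) (x : (cech e' K' d).X i)
    (σ : Simplex (Fin (r + 1)) i) :
    ((((cechMapOf hφ K' K hK d).f i).hom x : Cochain (fun s => locDeg e K s d) i) σ : J → L A r) =
      extL φ ((x : Cochain (fun s => locDeg e' K' s d) i) σ : J' → L A r) :=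
  rfl

/-- `cechMapOf` commutes with the inclusions `Č(K₁) ↪ Č(K₂)`.
[cite: Hartshorne1977, III Thm. 5.1 (proof, p. 225)] -/
theorem inclusion_comp_cechMapOf (hφ : IsDegZero e e' φ) (K₁' K₂' : Submodule (P A r) (J' → P A r))
    (h' : K₁' ≤ K₂') (K₁ K₂ : Submodule (P A r) (J → P A r)) (h : K₁ ≤ K₂)
    (hK₁ : K₁'.map φ ≤ K₁) (hK₂ : K₂'.map φ ≤ K₂) (d : ℤ) :
    inclusion e' K₁' K₂' h' d ≫ cechMapOf hφ K₂' K₂ hK₂ d =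
      cechMapOf hφ K₁' K₁ hK₁ d ≫ inclusion e K₁ K₂ h d := by
  ext i x
  rfl

/-- `cechMapOf` commutes with multiplication by a homogeneous polynomial (`φ_L` is `L`-linear).
[cite: Hartshorne1977, III Thm. 5.1 (proof, p. 225)] -/
theorem smulMap_comp_cechMapOf (hφ : IsDegZero e e' φ) (K' : Submodule (P A r) (J' → P A r))
    (K : Submodule (P A r) (J → P A r)) (hK : K'.map φ ≤ K) {c : ℤ} (g : P A r)
    (hg : toL A r g ∈ Ldeg A r c) (d d₁ : ℤ) (hd : d + c = d₁) :
    smulMap e' K' g hg d d₁ hd ≫ cechMapOf hφ K' K hK d₁ =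
      cechMapOf hφ K' K hK d ≫ smulMap e K g hg d d₁ hd := by
  ext i x
  rw [HomologicalComplex.comp_f, ModuleCat.comp_apply, HomologicalComplex.comp_f,
    ModuleCat.comp_apply]
  funext σ
  apply Subtype.ext
  rw [cechMapOf_f_apply_coe, smulMap_f_apply_coe, smulMap_f_apply_coe, cechMapOf_f_apply_coe,
    extL_smul]

/-- **Functoriality of `cechMapOf`: composites.**
[cite: Hartshorne1977, III Thm. 5.1 (proof, p. 225)] -/
theorem cechMapOf_comp {J'' : Type} [Fintype J''] [DecidableEq J''] {e'' : J'' → ℤ}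
    {ψ : (J'' → P A r) →ₗ[P A r] (J' → P A r)} (hφ : IsDegZero e e' φ) (hψ : IsDegZero e' e'' ψ)
    (K'' : Submodule (P A r) (J'' → P A r)) (K' : Submodule (P A r) (J' → P A r))
    (K : Submodule (P A r) (J → P A r)) (hK' : K''.map ψ ≤ K') (hK : K'.map φ ≤ K)
    (hKK : K''.map (φ ∘ₗ ψ) ≤ K) (d : ℤ) :
    cechMapOf (hφ.comp hψ) K'' K hKK d = cechMapOf hψ K'' K' hK' d ≫ cechMapOf hφ K' K hK d := by
  ext i x
  rw [HomologicalComplex.comp_f, ModuleCat.comp_apply]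
  funext σ
  apply Subtype.ext
  rw [cechMapOf_f_apply_coe, cechMapOf_f_apply_coe, cechMapOf_f_apply_coe, extL_comp]

/-- **Functoriality of `cechMapOf`: the identity.**
[cite: Hartshorne1977, III Thm. 5.1 (proof, p. 225)] -/
theorem cechMapOf_id [Fintype J] [DecidableEq J] (K : Submodule (P A r) (J → P A r))
    (hK : K.map (LinearMap.id : (J → P A r) →ₗ[P A r] (J → P A r)) ≤ K) (d : ℤ) :
    cechMapOf (isDegZero_id (e := e)) K K hK d = 𝟙 (cech e K d) := by
  ext i x
  rw [HomologicalComplex.id_f, ModuleCat.id_apply]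
  funext σ
  apply Subtype.ext
  rw [cechMapOf_f_apply_coe, extL_id]

end CechMap

/-! ### The induced map of quotient complexes `Č_d(F_{e'} ⧸ K') ⟶ Č_d(F_e ⧸ K)` -/

section QuotMap

variable {e e' φ}

/-- **The map of Čech complexes of graded quotients `Č_d(F_{e'} ⧸ K') ⟶ Č_d(F_e ⧸ K)` induced by
a degree-zero `φ : F_{e'} → F_e` with `φ(K') ⊆ K`** (`cokernel.map` of the square of `cechMapOf`s
over the inclusions): the Čech complex of `M~(d)` is functorial in the graded module `M`.
[cite: Hartshorne1977, III Thm. 5.1 (proof, p. 225)]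
[cite: GortzWedhorn2020, (13.1) (PDF p. 466)] -/
def quotMapOf (hφ : IsDegZero e e' φ) (K' : Submodule (P A r) (J' → P A r))
    (K : Submodule (P A r) (J → P A r)) (hK : K'.map φ ≤ K) (d : ℤ) :
    quot e' K' d ⟶ quot e K d :=
  cokernel.map (inclusion e' K' ⊤ le_top d) (inclusion e K ⊤ le_top d) (cechMapOf hφ K' K hK d)
    (cechMapOf hφ ⊤ ⊤ (by simp) d)
    (inclusion_comp_cechMapOf hφ K' ⊤ le_top K ⊤ le_top hK (by simp) d)

/-- `coker.π ≫ quotMapOf = cechMapOf ≫ coker.π`.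
[cite: Hartshorne1977, III Thm. 5.1 (proof, p. 225)] -/
@[reassoc] theorem π_comp_quotMapOf (hφ : IsDegZero e e' φ) (K' : Submodule (P A r) (J' → P A r))
    (K : Submodule (P A r) (J → P A r)) (hK : K'.map φ ≤ K) (d : ℤ) :
    cokernel.π (inclusion e' K' ⊤ le_top d) ≫ quotMapOf hφ K' K hK d =
      cechMapOf hφ ⊤ ⊤ (by simp) d ≫ cokernel.π (inclusion e K ⊤ le_top d) :=
  cokernel.π_desc _ _ _

/-- **`quotMapOf` is `P`-linear**: it commutes with multiplication by homogeneous polynomials on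
the quotient complexes (`quotSMul`). [cite: Hartshorne1977, III Thm. 5.1 (proof, p. 225)] -/
theorem quotSMul_comp_quotMapOf (hφ : IsDegZero e e' φ) (K' : Submodule (P A r) (J' → P A r))
    (K : Submodule (P A r) (J → P A r)) (hK : K'.map φ ≤ K) {c : ℤ} (g : P A r)
    (hg : toL A r g ∈ Ldeg A r c) (d d₁ : ℤ) (hd : d + c = d₁) :
    quotSMul e' K' g hg d d₁ hd ≫ quotMapOf hφ K' K hK d₁ =
      quotMapOf hφ K' K hK d ≫ quotSMul e K g hg d d₁ hd := by
  rw [← cancel_epi (cokernel.π (inclusion e' K' ⊤ le_top d)), π_comp_quotSMul_assoc,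
    π_comp_quotMapOf, π_comp_quotMapOf_assoc, π_comp_quotSMul, ← Category.assoc,
    smulMap_comp_cechMapOf, Category.assoc]

/-- `quotMapOf` is compatible with the restrictions `quotRes` (enlarging `K' ≤ K₂'`, `K ≤ K₂`).
[cite: Hartshorne1977, III Ex. 5.5 (p. 231)] -/
theorem quotRes_comp_quotMapOf (hφ : IsDegZero e e' φ) (K' K₂' : Submodule (P A r) (J' → P A r))
    (h' : K' ≤ K₂') (K K₂ : Submodule (P A r) (J → P A r)) (h : K ≤ K₂) (hK : K'.map φ ≤ K)
    (hK₂ : K₂'.map φ ≤ K₂) (d : ℤ) :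
    quotRes e' K' K₂' h' d ≫ quotMapOf hφ K₂' K₂ hK₂ d =
      quotMapOf hφ K' K hK d ≫ quotRes e K K₂ h d := by
  rw [← cancel_epi (cokernel.π (inclusion e' K' ⊤ le_top d)), π_comp_quotRes_assoc,
    π_comp_quotMapOf, π_comp_quotMapOf_assoc, π_comp_quotRes]

/-- **Functoriality of `quotMapOf`: composites.**
[cite: Hartshorne1977, III Thm. 5.1 (proof, p. 225)] -/
theorem quotMapOf_comp {J'' : Type} [Fintype J''] [DecidableEq J''] {e'' : J'' → ℤ}
    {ψ : (J'' → P A r) →ₗ[P A r] (J' → P A r)} (hφ : IsDegZero e e' φ) (hψ : IsDegZero e' e'' ψ)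
    (K'' : Submodule (P A r) (J'' → P A r)) (K' : Submodule (P A r) (J' → P A r))
    (K : Submodule (P A r) (J → P A r)) (hK' : K''.map ψ ≤ K') (hK : K'.map φ ≤ K)
    (hKK : K''.map (φ ∘ₗ ψ) ≤ K) (d : ℤ) :
    quotMapOf (hφ.comp hψ) K'' K hKK d = quotMapOf hψ K'' K' hK' d ≫ quotMapOf hφ K' K hK d := by
  rw [← cancel_epi (cokernel.π (inclusion e'' K'' ⊤ le_top d)), π_comp_quotMapOf,
    π_comp_quotMapOf_assoc, π_comp_quotMapOf, ← Category.assoc,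
    ← cechMapOf_comp hφ hψ ⊤ ⊤ ⊤ (by simp) (by simp) (by simp) d]

/-- **Functoriality of `quotMapOf`: the identity.**
[cite: Hartshorne1977, III Thm. 5.1 (proof, p. 225)] -/
theorem quotMapOf_id [Fintype J] [DecidableEq J] (K : Submodule (P A r) (J → P A r))
    (hK : K.map (LinearMap.id : (J → P A r) →ₗ[P A r] (J → P A r)) ≤ K) (d : ℤ) :
    quotMapOf (isDegZero_id (e := e)) K K hK d = 𝟙 (quot e K d) := by
  rw [← cancel_epi (cokernel.π (inclusion e K ⊤ le_top d)), π_comp_quotMapOf, cechMapOf_id,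
    Category.id_comp, Category.comp_id]

end QuotMap

/-! ### Presentation independence: `quotMapOf` is an isomorphism when `F' ⧸ K' ≅ F ⧸ K` -/

section Iso

variable {e e' φ}

/-- **Injectivity criterion on the localized pieces**: if `φ u ∈ K ⇒ u ∈ K'` then
`φ_L w ∈ K_{x_s} ⇒ w ∈ K'_{x_s}` for `w ∈ (F_{e'})_{x_s}` (clear denominators).
[cite: GortzWedhorn2020, (13.1) (PDF p. 466)] -/
theorem mem_loc_of_extL_mem_loc {K' : Submodule (P A r) (J' → P A r)}
    {K : Submodule (P A r) (J → P A r)} (hinj : ∀ u, φ u ∈ K → u ∈ K')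
    {s : Finset (Fin (r + 1))} {w : J' → L A r}
    (hw : w ∈ loc (⊤ : Submodule (P A r) (J' → P A r)) s) (hφw : extL φ w ∈ loc K s) :
    w ∈ loc K' s := by
  obtain ⟨M, u, -, hu⟩ := hw
  obtain ⟨N, k, hk, hNk⟩ := hφw
  have key : ιK A r J (φ (Xs A s ^ N • u)) = ιK A r J (Xs A s ^ M • k) := by
    rw [map_smul, ιK_smul, ιK_smul, toL_Xs_pow, toL_Xs_pow, ← extL_ιK, ← hu, extL_smul, smul_smul,
      ← hNk, smul_smul, mul_comm]
  have hmem : Xs A s ^ N • u ∈ K' := hinj _ (by rw [ιK_injective key]; exact K.smul_mem _ hk)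
  refine ⟨N + M, Xs A s ^ N • u, hmem, ?_⟩
  rw [← xs_smul_ιK, ← hu, smul_smul, ← xs_add, Nat.cast_add]

/-- **`quotMapOf` is injective in every degree** when `φ⁻¹(K) ⊆ K'` (i.e. `F_{e'} ⧸ K' → F_e ⧸ K` is
injective). [cite: GortzWedhorn2020, (13.1) (PDF p. 466)] -/
theorem injective_quotMapOf_f (hφ : IsDegZero e e' φ) (K' : Submodule (P A r) (J' → P A r))
    (K : Submodule (P A r) (J → P A r)) (hK : K'.map φ ≤ K) (hinj : ∀ u, φ u ∈ K → u ∈ K')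
    (d i : ℤ) : Function.Injective ((quotMapOf hφ K' K hK d).f i).hom := by
  refine injective_cokernel_map_f (inclusion e' K' ⊤ le_top d) (inclusion e K ⊤ le_top d)
    (cechMapOf hφ K' K hK d) (cechMapOf hφ ⊤ ⊤ (by simp) d)
    (inclusion_comp_cechMapOf hφ K' ⊤ le_top K ⊤ le_top hK (by simp) d) i fun x hx => ?_
  rw [mem_range_inclusion_f_iff] at hx ⊢
  intro σ
  have h1 := hx σ
  rw [cechMapOf_f_apply_coe] at h1
  exact mem_loc_of_extL_mem_loc hinj ((mem_locDeg _ _).1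
    ((x : Cochain (fun s => locDeg e' (⊤ : Submodule (P A r) (J' → P A r)) s d) i) σ).2).1 h1

/-- **Surjectivity on the localized graded pieces**: if `F_e = φ(F_{e'}) + K` with `K` graded and
`φ` of degree zero, every `y ∈ ((F_e)_{x_s})_d` is `φ_L x + k` with `x ∈ ((F_{e'})_{x_s})_d`,
`k ∈ (K_{x_s})_d` (project a decomposition of `x_s^N y` onto its degree).
[cite: GortzWedhorn2020, (13.1) (PDF p. 466)] -/
theorem exists_extL_add_of_sup_eq_top (hφ : IsDegZero e e' φ) {K : Submodule (P A r) (J → P A r)}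
    (hKg : IsGraded e K) (hsurj : LinearMap.range φ ⊔ K = ⊤) {s : Finset (Fin (r + 1))} {d : ℤ}
    {y : J → L A r} (hy : y ∈ locDeg e (⊤ : Submodule (P A r) (J → P A r)) s d) :
    ∃ x ∈ locDeg e' (⊤ : Submodule (P A r) (J' → P A r)) s d, ∃ k ∈ locDeg e K s d,
      y = extL φ x + k := by
  obtain ⟨⟨N, v, -, hNv⟩, hydeg⟩ := (mem_locDeg _ _).1 hy
  have hv : v ∈ LinearMap.range φ ⊔ K := by rw [hsurj]; exact Submodule.mem_top
  obtain ⟨_, ⟨u, rfl⟩, k₀, hk₀, huk⟩ := Submodule.mem_sup.1 hv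
  set D : ℤ := d + N * s.card with hD
  have hv' : xs A s N • y ∈ Kdeg A r e D := xs_smul_mem_Kdeg e hydeg s N
  have hsum : extL φ (ιK A r J' (projDeg e' D u)) + ιK A r J (projDeg e D k₀) = xs A s N • y := by
    rw [extL_ιK, hφ, ← map_add, ← map_add, huk, ιK_projDeg, ← hNv, KfilterDeg_of_mem e hv']
  refine ⟨xs A s (-(N : ℤ)) • ιK A r J' (projDeg e' D u), (mem_locDeg _ _).2 ⟨?_, ?_⟩,
    xs A s (-(N : ℤ)) • ιK A r J (projDeg e D k₀), (mem_locDeg _ _).2 ⟨?_, ?_⟩, ?_⟩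
  · exact xs_smul_mem_loc ⊤ (ιK_mem_loc ⊤ Submodule.mem_top) _
  · have := xs_smul_mem_Kdeg e' (ιK_projDeg_mem_Kdeg e' D u) s (-(N : ℤ))
    rwa [hD, show d + (N : ℤ) * s.card + -(N : ℤ) * s.card = d by ring] at this
  · exact xs_smul_mem_loc K (ιK_mem_loc K (hKg D k₀ hk₀)) _
  · have := xs_smul_mem_Kdeg e (ιK_projDeg_mem_Kdeg e D k₀) s (-(N : ℤ))
    rwa [hD, show d + (N : ℤ) * s.card + -(N : ℤ) * s.card = d by ring] at this
  · rw [extL_smul, ← smul_add, hsum, smul_smul, xs_neg_mul_xs, one_smul]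

/-- **`quotMapOf` is surjective in every degree** when `F_e = φ(F_{e'}) + K` (`K` graded, `φ` of
degree zero). [cite: GortzWedhorn2020, (13.1) (PDF p. 466)] -/
theorem surjective_quotMapOf_f (hφ : IsDegZero e e' φ) (K' : Submodule (P A r) (J' → P A r))
    {K : Submodule (P A r) (J → P A r)} (hKg : IsGraded e K) (hK : K'.map φ ≤ K)
    (hsurj : LinearMap.range φ ⊔ K = ⊤) (d i : ℤ) :
    Function.Surjective ((quotMapOf hφ K' K hK d).f i).hom := by
  intro z
  obtain ⟨y, rfl⟩ := surjective_cokernel_π_f (inclusion e K ⊤ le_top d) i z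
  have hdec : ∀ σ : Simplex (Fin (r + 1)) i,
      ∃ x ∈ locDeg e' (⊤ : Submodule (P A r) (J' → P A r)) σ.1 d, ∃ k ∈ locDeg e K σ.1 d,
        ((y : Cochain (fun s => locDeg e (⊤ : Submodule (P A r) (J → P A r)) s d) i) σ :
          J → L A r) = extL φ x + k := fun σ =>
    exists_extL_add_of_sup_eq_top hφ hKg hsurj
      ((y : Cochain (fun s => locDeg e (⊤ : Submodule (P A r) (J → P A r)) s d) i) σ).2
  choose x hx k hk hyxk using hdec
  let xc : (cech e' (⊤ : Submodule (P A r) (J' → P A r)) d).X i :=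
    (fun σ => ⟨x σ, hx σ⟩ : Cochain (fun s => locDeg e' (⊤ : Submodule (P A r) (J' → P A r)) s d) i)
  let kc : (cech e K d).X i := (fun σ => ⟨k σ, hk σ⟩ : Cochain (fun s => locDeg e K s d) i)
  have hy : y = ((cechMapOf hφ ⊤ ⊤ (by simp) d).f i).hom xc +
      ((inclusion e K ⊤ le_top d).f i).hom kc := by
    funext σ
    apply Subtype.ext
    exact hyxk σ
  refine ⟨((cokernel.π (inclusion e' K' ⊤ le_top d)).f i).hom xc, ?_⟩
  rw [← ModuleCat.comp_apply, ← HomologicalComplex.comp_f, π_comp_quotMapOf,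
    HomologicalComplex.comp_f, ModuleCat.comp_apply, hy, map_add, cokernel_π_f_apply_f, add_zero]

/-- **Presentation independence of the Čech complex of a graded quotient**: if the degree-zero
`φ : F_{e'} → F_e` induces an isomorphism `F_{e'} ⧸ K' ≅ F_e ⧸ K` of graded modules
(`φ(K') ⊆ K`, `φ⁻¹(K) ⊆ K'`, `φ(F_{e'}) + K = F_e`; `K` graded), then
`quotMapOf φ : Č_d(F_{e'} ⧸ K') ⟶ Č_d(F_e ⧸ K)` is an isomorphism of cochain complexes for every
`d` —
the Čech complex of the coherent sheaf `M~(d)` on the standard cover depends only on the graded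
module `M`, not on its presentation as a quotient of a free graded module.
[cite: Hartshorne1977, III Thm. 5.1 (proof, p. 225)]
[cite: GortzWedhorn2020, (13.1) (PDF p. 466)] -/
theorem isIso_quotMapOf (hφ : IsDegZero e e' φ) (K' : Submodule (P A r) (J' → P A r))
    {K : Submodule (P A r) (J → P A r)} (hKg : IsGraded e K) (hK : K'.map φ ≤ K)
    (hinj : ∀ u, φ u ∈ K → u ∈ K') (hsurj : LinearMap.range φ ⊔ K = ⊤) (d : ℤ) :
    IsIso (quotMapOf hφ K' K hK d) := by
  haveI : ∀ i, IsIso ((quotMapOf hφ K' K hK d).f i) := fun i =>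
    (ConcreteCategory.isIso_iff_bijective _).2
      ⟨injective_quotMapOf_f hφ K' K hK hinj d i, surjective_quotMapOf_f hφ K' hKg hK hsurj d i⟩
  exact HomologicalComplex.Hom.isIso_of_components _

/-- Hence isomorphic graded quotients have isomorphic Čech cohomology in every degree.
[cite: Hartshorne1977, III Thm. 5.1 (proof, p. 225)] -/
theorem isIso_homologyMap_quotMapOf (hφ : IsDegZero e e' φ) (K' : Submodule (P A r) (J' → P A r))
    {K : Submodule (P A r) (J → P A r)} (hKg : IsGraded e K) (hK : K'.map φ ≤ K)
    (hinj : ∀ u, φ u ∈ K → u ∈ K') (hsurj : LinearMap.range φ ⊔ K = ⊤) (d i : ℤ) :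
    IsIso (HomologicalComplex.homologyMap (quotMapOf hφ K' K hK d) i) := by
  haveI := isIso_quotMapOf hφ K' hKg hK hinj hsurj d
  infer_instance

end Iso

end LaurentCech

end Literature.Algebra.Homology

end
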